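import Summits.QuantumFields.YangMills.Theorems.LuscherReductionOneSiteLevelsKacInner
import Summits.QuantumFields.YangMills.Theorems.LuscherReductionOneSiteLevelsValleyReduction
import HarnessLib

/-!
# Route `LuscherReduction`, child item `OneSiteTail` (stmt-QuantumFields-20204): INNER in COUNT MODE — layers I + II PROVED;
# the remaining hypothesis is the FLAT KAC-FORM COUNT «FlatKacCount» (ONE's layer III with constants polynomial in the energy)
# seat ym-cruxidea-19978-2 g11; TURNKEY for a prover (`--supports stmt-QuantumFields-20204`); def-free; companion of
# `…OneSiteTailDoors.lean` (HS ratio + count ⇒ tail) and `…OneSiteTailCount.lean` (OUTER-count + IMS seam: INNERc ⇒ «FSB»).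

ONE's INNER lane (crux `OneSiteLevels`, closed) is `innerOfFlatKac k = inner_of_jumpEnergyLower k ∘ jumpEnergyLower_of_flatKac k`
(`…KacJump`, `…KacInner`) over the flat Kac-form bound `FlatKacFormBound k` (`…KacFlat`, from AL1).  Its proof mentions the level index
`k` ONLY through the energy symbol `E_k = physLevel (k+1)` and the list `fs : Fin k → ZM → ℝ` of flat constraints: the gnomonic
transport (`integral_sq_le_of_chartRep`, `integral_action_mul_sq_ge`, `latticeJump_ge_flatJumpBall`, `flatJump_le_flatJumpBall_add_exp`,
`l2_phiPullback`, `assembly_ineq`) is energy-blind.  COUNT MODE therefore re-runs layers I–II VERBATIM with a threshold `η ∈ [0, c₁ log B]`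
moving with `B`, `n(η) ≤ C(1+η)^p` constraints and error constants polynomial in `η` — absorbed because `(1 + c₁ log B)^q·λ_b → 0`
(`exists_pow_log_mul_bareLambda_le`).

 §1 `exists_pow_log_mul_bareLambda_le` — `∀ c₀>0, c₁, q: ∃ B₁ ≥ 2, ∀ B ≥ B₁, ∀ η ∈ [0, c₁ log B], (1+η)^q·λ_b ≤ c₀` (`(log B)^q = o(B^{1/3})`).
 §2 ★ `innerCount_of_jumpEnergyLowerCount : JELc → INNERc` — layer I in count mode (`qform_le_of_latticeJump_ge` at threshold `2η`, the
    polynomial error `C₁(1+2η)^qλ_b²` absorbed into `ηλ_b + |C₁|3^qλ_b²`).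
 §3 ★ `jumpEnergyLowerCount_of_flatKacCount : FKc → JELc` — layer II in count mode (the body of `jumpEnergyLower_of_flatKac` with
    `E_k ↦ η`, `Fin k ↦ Fin n`, validity range `(1+η)^q λ_b ≤ min c₀ (1/600)`; error `(600 + 601|C'| + 2)(1+η)^{q+1}λ_b²`).
 §4 ★★ `innerCount_of_flatKacCount : FKc → INNERc`.
   INNERc (verbatim the hypothesis of `OSTailCount.femtoSubspaceBound_of_innerCount`):
     `∀ c₁>0 ∃ C>0, p, C₁, B₁ ≥ 2: ∀ B ≥ B₁, ∀ η ∈ [0, c₁ log B], ∃ n ≤ C(1+η)^p physical φ_i: ∀ physical ψ ⊥ φ_i,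
      ⟨cos Θ_B ψ, K_B cos Θ_B ψ⟩ ≤ linkCE·e^{−ηλ_b + C₁λ_b²}‖cos Θ_B ψ‖²`;
   JELc (jump currency): same quantifiers (+ `∃ q`), conclusion `(ηλ_b − C₁(1+η)^qλ_b²)∫g² ≤ latticeJump B g + ∫ B·S·g²`, `g = magWeight B (cos Θ_B ψ)`;
   FKc (flat, `κ = 7`) = «FlatKacCount»:
     `∃ C>0, p, C', q, c₀>0: ∀ E ≥ 0, ∃ n ≤ C(1+E)^p flat constraints fs_i (continuous, bounded, colour-invariant, integrable):
      ∀ t>0 with (1+E)^q t ≤ c₀, ∀ measurable bounded colour-invariant g supported in ‖x‖ ≤ 7/√t with ∫ g·fs_i = 0,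
      (E − C'(1+E)^q t)∫g² ≤ kacForm t g`.
WHAT REMAINS for stmt-QuantumFields-20204 after Doors + Count + this file: «FlatKacCount» ALONE — ONE's flat lane (`flatKac_window`:
span `kacForm_span_ge`, cross `abs_kacBil_span_le`, remainder `kacForm_remainder_ge`, at family index `m(E)` with `physLevel (m+2) ≥ E + 96·49 + 3`,
`n = m + 1 ≤ dimBound (E + 4707) + 2` constraints by Literature `le_physLevel_of_dimBound_lt`) with the three constants `K, Cc, D₀` and the time range
`t₀` tracked POLYNOMIALLY in `physLevel (m+1)` — i.e. QUANTITATIVE AL1 (sup-norms and Sobolev norms, `‖H₀f_j‖`, `‖Vf_j‖` of the Lüscher eigenfunctions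
polynomial in the level; Agmon–Caccioppoli as in `YangMillsMatrixModelAL1Holds` N5–N6, made explicit) plus `dimBound E ≤ C(1+E)^p` (explicit
ball volumes in `ℝ⁹`).  That is the genuine analytic content of the child item; everything else is now kernel-checked.
HONEST FRAMING: near-verbatim copies of ONE's layers I–II with a moving threshold + elementary asymptotics; femto rung R2b1; not a gap, not Clay.
Sorry-free; no `def`, no named fact.  References: [cite: Luscher1983, §3]; [cite: SimonB1983DiscreteSpectrum, §3, Cor. 4]; [cite: LiebYau1988, (2.9)–(2.11)];
[cite: ReedSimonIV1978, Thm. XIII.1–2, XIII.64]; [cite: Agmon1982, Thm. 5.1].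
-/

set_option autoImplicit false

noncomputable section

open MeasureTheory Filter Topology Asymptotics Real
open scoped ENNReal
open Literature.MathematicalPhysics.QuantumFieldTheory
open Literature.MathematicalPhysics.QuantumLattice
open Literature.Analysis.OperatorTheory.YMMatrixModel

namespace Summit.QuantumFields.YangMills.Theorems.FemtoTransferGap.OSTailInner

/-! ## §1 Polynomial-in-`log B` losses are absorbed by `λ_b → 0` -/

/-- For `c₀ > 0`, any `c₁` and `q`: eventually `(1+η)^q·λ_b(B) ≤ c₀` for ALL `η ∈ [0, c₁ log B]` (`(log B)^q = o(B^{1/3})`,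
`λ_b ≤ 2B^{−1/3}`). [folklore] -/
theorem exists_pow_log_mul_bareLambda_le {c₀ : ℝ} (hc₀ : 0 < c₀) (c₁ : ℝ) (q : ℕ) :
    ∃ B₁ : ℝ, 2 ≤ B₁ ∧ ∀ B : ℝ, B₁ ≤ B → ∀ η : ℝ, 0 ≤ η → η ≤ c₁ * Real.log B → (1 + η) ^ q * bareLambda B ≤ c₀ := by
  set A : ℝ := (2 * (1 + |c₁|)) ^ q * 2 with hA
  have hA0 : 0 < A := by rw [hA]; positivity
  have h := (isLittleO_log_rpow_rpow_atTop (q : ℝ) (by norm_num : (0 : ℝ) < 1 / 3)).tendsto_div_nhds_zero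
  have h2 : Tendsto (fun B : ℝ => A * (Real.log B ^ (q : ℝ) / B ^ ((1 : ℝ) / 3))) atTop (𝓝 (A * 0)) := h.const_mul A
  rw [mul_zero] at h2
  have hev : ∀ᶠ B : ℝ in atTop, A * (Real.log B ^ (q : ℝ) / B ^ ((1 : ℝ) / 3)) < c₀ := h2.eventually (Iio_mem_nhds hc₀)
  obtain ⟨T, hT⟩ := Filter.eventually_atTop.1 (hev.and (Filter.eventually_ge_atTop (Real.exp 1)))
  refine ⟨max T 2, le_max_right _ _, fun B hB η hη0 hηc => ?_⟩
  obtain ⟨hlt, hBe⟩ := hT B ((le_max_left _ _).trans hB)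
  have hB2 : 2 ≤ B := (le_max_right _ _).trans hB
  have hBpos : 0 < B := by linarith
  have hlog1 : 1 ≤ Real.log B := by
    have := Real.log_le_log (Real.exp_pos 1) hBe
    rwa [Real.log_exp] at this
  have hlog0 : 0 ≤ Real.log B := by linarith
  -- `1 + η ≤ 2(1+|c₁|) log B`
  have hc : c₁ * Real.log B ≤ |c₁| * Real.log B := mul_le_mul_of_nonneg_right (le_abs_self c₁) hlog0
  have habs : 0 ≤ |c₁| * Real.log B := mul_nonneg (abs_nonneg c₁) hlog0
  have h1 : 1 + η ≤ 2 * (1 + |c₁|) * Real.log B := by nlinarith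
  have hpow : (1 + η) ^ q ≤ (2 * (1 + |c₁|)) ^ q * Real.log B ^ q := by
    rw [← mul_pow]; exact pow_le_pow_left₀ (by linarith) h1 q
  -- `λ_b ≤ 2 B^{−1/3} = 2 / B^{1/3}`
  have hr : 0 < B ^ ((1 : ℝ) / 3) := Real.rpow_pos_of_pos hBpos _
  have hlam : bareLambda B ≤ 2 * (B ^ ((1 : ℝ) / 3))⁻¹ := by
    have e : (-(1 : ℝ) / 3) = -((1 : ℝ) / 3) := by ring
    rw [bareLambda_eq_rpow hBpos, e, Real.rpow_neg hBpos.le]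
    have h2le : (2 : ℝ) ^ ((1 : ℝ) / 3) ≤ 2 := by
      calc (2 : ℝ) ^ ((1 : ℝ) / 3) ≤ (2 : ℝ) ^ (1 : ℝ) := Real.rpow_le_rpow_of_exponent_le (by norm_num) (by norm_num)
        _ = 2 := Real.rpow_one 2
    exact mul_le_mul_of_nonneg_right h2le (inv_nonneg.2 hr.le)
  have hq : Real.log B ^ q = Real.log B ^ (q : ℝ) := (Real.rpow_natCast _ _).symm
  have hl0 : 0 ≤ bareLambda B := (bareLambda_pos' hBpos).le
  have hlogq : 0 ≤ Real.log B ^ q := pow_nonneg hlog0 q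
  calc (1 + η) ^ q * bareLambda B ≤ ((2 * (1 + |c₁|)) ^ q * Real.log B ^ q) * (2 * (B ^ ((1 : ℝ) / 3))⁻¹) :=
        mul_le_mul hpow hlam hl0 (by positivity)
    _ = A * (Real.log B ^ (q : ℝ) / B ^ ((1 : ℝ) / 3)) := by rw [hA, ← hq, div_eq_mul_inv]; ring
    _ ≤ c₀ := hlt.le

/-! ## §2 Layer I in count mode: jump currency ⟹ INNERc -/

/-- ★ **Layer I in count mode** — JELc ⟹ INNERc: apply the jump-Dirichlet reduction `qform_le_of_latticeJump_ge` at threshold `2η`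
(still `≤ 2c₁ log B`); the polynomial error `C₁(1+2η)^qλ_b²` is `≤ ηλ_b + |C₁|3^qλ_b²` once `(|C₁|+1)(1+2η)^qλ_b ≤ 1`
(`exists_pow_log_mul_bareLambda_le`), so the count and the constant stay B-uniform (`C ↦ 2^p C`, `C₁ ↦ |C₁|3^q`).
[cite: LiebYau1988, (2.9)–(2.11)] [cite: Luscher1983, §3] -/
theorem innerCount_of_jumpEnergyLowerCount
    (h : ∀ c₁ : ℝ, 0 < c₁ → ∃ C : ℝ, ∃ p : ℕ, ∃ C₁ : ℝ, ∃ q : ℕ, ∃ B₁ : ℝ, 0 < C ∧ 2 ≤ B₁ ∧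
      ∀ B : ℝ, B₁ ≤ B → ∀ η : ℝ, 0 ≤ η → η ≤ c₁ * Real.log B →
      ∃ n : ℕ, (n : ℝ) ≤ C * (1 + η) ^ p ∧ ∃ φs : Fin n → Cfg → ℝ, (∀ i, IsPhys (φs i)) ∧
        ∀ ψ : Cfg → ℝ, IsPhys ψ → (∀ i, l2 ψ (φs i) = 0) →
          (η * bareLambda B - C₁ * (1 + η) ^ q * bareLambda B ^ 2) *
              ∫ U, magWeight B (fun U => Real.cos (onePhase (onePhaseScale B) U) * ψ U) U ^ 2 ∂cfgMeasure ≤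
            latticeJump B (magWeight B (fun U => Real.cos (onePhase (onePhaseScale B) U) * ψ U)) +
              ∫ U, B * wilsonAction su2Rep U * magWeight B (fun U => Real.cos (onePhase (onePhaseScale B) U) * ψ U) U ^ 2 ∂cfgMeasure) :
    ∀ c₁ : ℝ, 0 < c₁ → ∃ C : ℝ, ∃ p : ℕ, ∃ C₁ B₁ : ℝ, 0 < C ∧ 2 ≤ B₁ ∧ ∀ B : ℝ, B₁ ≤ B → ∀ η : ℝ, 0 ≤ η → η ≤ c₁ * Real.log B →
      ∃ n : ℕ, (n : ℝ) ≤ C * (1 + η) ^ p ∧ ∃ φs : Fin n → (GaugeConfig 3 1 SU2 → ℝ), (∀ i, IsPhys (φs i)) ∧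
        ∀ ψ : GaugeConfig 3 1 SU2 → ℝ, IsPhys ψ → (∀ i, l2 ψ (φs i) = 0) →
          qform su2Rep B (fun U => Real.cos (onePhase (onePhaseScale B) U) * ψ U) (fun U => Real.cos (onePhase (onePhaseScale B) U) * ψ U)
            ≤ linkCE B * Real.exp (-(η * bareLambda B) + C₁ * bareLambda B ^ 2)
              * l2 (fun U => Real.cos (onePhase (onePhaseScale B) U) * ψ U) (fun U => Real.cos (onePhase (onePhaseScale B) U) * ψ U) := by
  intro c₁ hc₁
  obtain ⟨C, p, C₁, q, B₁, hC, hB₁, hjump⟩ := h (2 * c₁) (by linarith)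
  obtain ⟨Bh, hBh2, hBh⟩ := exists_pow_log_mul_bareLambda_le (c₀ := 1 / (|C₁| + 1)) (by positivity) (2 * c₁) q
  refine ⟨C * 2 ^ p, p, |C₁| * 3 ^ q, max B₁ Bh, by positivity, hB₁.trans (le_max_left _ _), fun B hB η hη0 hηc => ?_⟩
  have hBB₁ : B₁ ≤ B := (le_max_left _ _).trans hB
  have hBBh : Bh ≤ B := (le_max_right _ _).trans hB
  have hB2 : 2 ≤ B := hB₁.trans hBB₁
  have hBpos : 0 < B := by linarith
  have hl0 : 0 < bareLambda B := bareLambda_pos' hBpos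
  have h2η0 : 0 ≤ 2 * η := by linarith
  have h2ηc : 2 * η ≤ 2 * c₁ * Real.log B := by linarith
  obtain ⟨n, hn, φs, hφs, hψ⟩ := hjump B hBB₁ (2 * η) h2η0 h2ηc
  refine ⟨n, ?_, φs, hφs, fun ψ hψphys horth => ?_⟩
  · have h1 : (1 + 2 * η) ^ p ≤ (2 * (1 + η)) ^ p := pow_le_pow_left₀ (by linarith) (by linarith) p
    rw [mul_pow] at h1
    calc (n : ℝ) ≤ C * (1 + 2 * η) ^ p := hn
      _ ≤ C * (2 ^ p * (1 + η) ^ p) := mul_le_mul_of_nonneg_left h1 hC.le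
      _ = C * 2 ^ p * (1 + η) ^ p := by ring
  · have hkey := hψ ψ hψphys horth
    set x := bareLambda B with hx
    have hM0 : 0 ≤ ∫ U, magWeight B (fun U => Real.cos (onePhase (onePhaseScale B) U) * ψ U) U ^ 2 ∂cfgMeasure :=
      integral_nonneg fun U => sq_nonneg _
    -- the polynomial error is absorbed: `C₁ (1+2η)^q x² ≤ η x + |C₁| 3^q x²`
    have hpow0 : 0 ≤ (1 + 2 * η) ^ q := pow_nonneg (by linarith) q
    have hC₁le : C₁ * (1 + 2 * η) ^ q * x ^ 2 ≤ |C₁| * (1 + 2 * η) ^ q * x ^ 2 :=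
      mul_le_mul_of_nonneg_right (mul_le_mul_of_nonneg_right (le_abs_self C₁) hpow0) (sq_nonneg x)
    have herr : C₁ * (1 + 2 * η) ^ q * x ^ 2 ≤ η * x + |C₁| * 3 ^ q * x ^ 2 := by
      rcases le_or_gt 1 η with h1η | hη1
      · have hh := hBh B hBBh (2 * η) h2η0 h2ηc
        have h2 : |C₁| * (1 + 2 * η) ^ q * x ≤ 1 := by
          calc |C₁| * (1 + 2 * η) ^ q * x = |C₁| * ((1 + 2 * η) ^ q * x) := by ring
            _ ≤ (|C₁| + 1) * ((1 + 2 * η) ^ q * x) :=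
                mul_le_mul_of_nonneg_right (by linarith [abs_nonneg C₁]) (mul_nonneg hpow0 hl0.le)
            _ ≤ (|C₁| + 1) * (1 / (|C₁| + 1)) := mul_le_mul_of_nonneg_left hh (by positivity)
            _ = 1 := by field_simp
        have h3 : |C₁| * (1 + 2 * η) ^ q * x ^ 2 ≤ η * x := by
          calc |C₁| * (1 + 2 * η) ^ q * x ^ 2 = (|C₁| * (1 + 2 * η) ^ q * x) * x := by ring
            _ ≤ 1 * x := mul_le_mul_of_nonneg_right h2 hl0.le
            _ ≤ η * x := mul_le_mul_of_nonneg_right h1η hl0.le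
        have h4 : 0 ≤ |C₁| * 3 ^ q * x ^ 2 := by positivity
        linarith
      · have h3 : (1 + 2 * η) ^ q ≤ 3 ^ q := pow_le_pow_left₀ (by linarith) (by linarith) q
        have h4 : |C₁| * (1 + 2 * η) ^ q * x ^ 2 ≤ |C₁| * 3 ^ q * x ^ 2 :=
          mul_le_mul_of_nonneg_right (mul_le_mul_of_nonneg_left h3 (abs_nonneg _)) (sq_nonneg x)
        have h5 : 0 ≤ η * x := mul_nonneg hη0 hl0.le
        linarith
    have hle : η * x - |C₁| * 3 ^ q * x ^ 2 ≤ 2 * η * x - C₁ * (1 + 2 * η) ^ q * x ^ 2 := by linarith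
    have ha := (mul_le_mul_of_nonneg_right hle hM0).trans hkey
    have key := qform_le_of_latticeJump_ge (a := η * x - |C₁| * 3 ^ q * x ^ 2) hBpos
      (isPhys_cos_onePhase_mul (onePhaseScale B) hψphys) ha
    have e : -(η * x - |C₁| * 3 ^ q * x ^ 2) = -(η * x) + |C₁| * 3 ^ q * x ^ 2 := by ring
    rw [e] at key
    exact key

/-! ## §3 Layer II in count mode: the flat Kac-form count ⟹ jump currency -/

/-- ★ **Layer II in count mode** — FKc ⟹ JELc: the body of `jumpEnergyLower_of_flatKac` with `E_k ↦ η`, `Fin k ↦ Fin n(η)`;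
validity `(1+η)^q λ_b ≤ min c₀ (1/600)` for all `η ≤ c₁ log B` by `exists_pow_log_mul_bareLambda_le`; the lattice constraints are the
gnomonic pull-backs `φ_i = phiFlat B fs_i ∘ gnCoord (λ_b/2)`; error constant `(600 + 601|C'| + 2)(1+η)^{q+1}`.
[cite: Luscher1983, §3] [cite: SimonB1983DiscreteSpectrum, §3] -/
theorem jumpEnergyLowerCount_of_flatKacCount
    (hF : ∃ C : ℝ, ∃ p : ℕ, ∃ C' : ℝ, ∃ q : ℕ, ∃ c₀ : ℝ, 0 < C ∧ 0 < c₀ ∧ ∀ E : ℝ, 0 ≤ E →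
      ∃ n : ℕ, (n : ℝ) ≤ C * (1 + E) ^ p ∧ ∃ fs : Fin n → ZM → ℝ,
        (∀ i, Continuous (fs i)) ∧ (∀ i, ∃ M : ℝ, ∀ x, |fs i x| ≤ M) ∧ (∀ i, IsGaugeInv (fs i)) ∧ (∀ i, Integrable (fs i)) ∧
        ∀ t : ℝ, 0 < t → (1 + E) ^ q * t ≤ c₀ → ∀ g : ZM → ℝ, Measurable g → (∃ M : ℝ, ∀ x, |g x| ≤ M) → IsGaugeInv g →
          (∀ x, g x ≠ 0 → ‖x‖ ≤ 7 / Real.sqrt t) → (∀ i, ∫ x, g x * fs i x = 0) →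
          (E - C' * (1 + E) ^ q * t) * ∫ x, g x ^ 2 ≤ kacForm t g) :
    ∀ c₁ : ℝ, 0 < c₁ → ∃ C : ℝ, ∃ p : ℕ, ∃ C₁ : ℝ, ∃ q : ℕ, ∃ B₁ : ℝ, 0 < C ∧ 2 ≤ B₁ ∧
      ∀ B : ℝ, B₁ ≤ B → ∀ η : ℝ, 0 ≤ η → η ≤ c₁ * Real.log B →
      ∃ n : ℕ, (n : ℝ) ≤ C * (1 + η) ^ p ∧ ∃ φs : Fin n → Cfg → ℝ, (∀ i, IsPhys (φs i)) ∧
        ∀ ψ : Cfg → ℝ, IsPhys ψ → (∀ i, l2 ψ (φs i) = 0) →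
          (η * bareLambda B - C₁ * (1 + η) ^ q * bareLambda B ^ 2) *
              ∫ U, magWeight B (fun U => Real.cos (onePhase (onePhaseScale B) U) * ψ U) U ^ 2 ∂cfgMeasure ≤
            latticeJump B (magWeight B (fun U => Real.cos (onePhase (onePhaseScale B) U) * ψ U)) +
              ∫ U, B * wilsonAction su2Rep U * magWeight B (fun U => Real.cos (onePhase (onePhaseScale B) U) * ψ U) U ^ 2 ∂cfgMeasure := by
  obtain ⟨C, p, C', q, c₀, hC, hc₀, hflat⟩ := hF
  intro c₁ hc₁
  obtain ⟨Bh, hBh2, hBh⟩ := exists_pow_log_mul_bareLambda_le (c₀ := min c₀ (1 / 600)) (lt_min hc₀ (by norm_num)) c₁ q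
  refine ⟨C, p, 600 + 601 * |C'| + 2, q + 1, Bh, hC, hBh2, fun B hB η hη0 hηc => ?_⟩
  obtain ⟨n, hn, fs, hfc, hfb, hfi, _hfint, hbound⟩ := hflat η hη0
  refine ⟨n, hn, ?_⟩
  -- parameters at coupling `B`: `t = λ_b`, `μ = t/2`, `R₀ = 7/√t`
  have hB2 : 2 ≤ B := hBh2.trans hB
  have hBpos : 0 < B := by linarith
  have ht : 0 < bareLambda B := bareLambda_pos' hBpos
  have hpow1 : 1 ≤ (1 + η) ^ q := one_le_pow₀ (by linarith)
  have hh := hBh B hB η hη0 hηc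
  have hrange : (1 + η) ^ q * bareLambda B ≤ c₀ := hh.trans (min_le_left _ _)
  have ht600 : bareLambda B ≤ 1 / 600 := by
    have h1 : bareLambda B ≤ (1 + η) ^ q * bareLambda B := le_mul_of_one_le_left ht.le hpow1
    exact h1.trans (hh.trans (min_le_right _ _))
  have ht4 : bareLambda B ≤ 1 / 4 := by linarith
  have hBt : B = 2 / bareLambda B ^ 3 := by
    have h := bareLambda_cube hBpos
    field_simp
    linarith
  have hμ : 0 < bareLambda B / 2 := by positivity
  have hsq : Real.sqrt (bareLambda B) ^ 2 = bareLambda B := Real.sq_sqrt ht.le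
  have hsqpos : 0 < Real.sqrt (bareLambda B) := Real.sqrt_pos.2 ht
  have hR₀ : (0 : ℝ) ≤ 7 / Real.sqrt (bareLambda B) := by positivity
  have hμR₀ : (bareLambda B / 2) ^ 2 * (7 / Real.sqrt (bareLambda B)) ^ 2 = 49 / 4 * bareLambda B := by
    rw [div_pow, div_pow, hsq]; field_simp; ring
  have hρ₀ : 0 < (bareLambda B / 2) ^ 9 * ((2 * π ^ 2)⁻¹) ^ 3 := by positivity
  have hwinφ : 6 * ((bareLambda B / 2) ^ 2 * (7 / Real.sqrt (bareLambda B)) ^ 2) ≤ 1 / 2 := by rw [hμR₀]; linarith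
  have hwin6 : 6 * ((bareLambda B / 2) ^ 2 * (7 / Real.sqrt (bareLambda B)) ^ 2) ≤ 1 := by linarith
  have h4R : (bareLambda B / 2) ^ 2 * (2 * (7 / Real.sqrt (bareLambda B))) ^ 2 =
      4 * ((bareLambda B / 2) ^ 2 * (7 / Real.sqrt (bareLambda B)) ^ 2) := by ring
  have hR6 : 6 * ((bareLambda B / 2) ^ 2 * (2 * (7 / Real.sqrt (bareLambda B))) ^ 2) ≤ 1 := by
    rw [h4R, hμR₀]; linarith
  -- the constraints
  refine ⟨fun i U => phiFlat B (fs i) (gnCoord (bareLambda B / 2) U), fun i => ?_, fun ψ hψ horth => ?_⟩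
  · obtain ⟨Mi, hMi⟩ := hfb i
    exact isPhys_gnPullback (measurable_phiFlat B (hfc i).measurable) ⟨_, abs_phiFlat_le hBpos ht4 hwinφ hMi⟩
      (isGaugeInv_phiFlat B (hfi i)) (bareLambda B / 2)
  -- the test function and its flat representative
  obtain ⟨Cψ, hCψ⟩ := hψ.bounded
  have hfphys : IsPhys (fun U => Real.cos (onePhase (onePhaseScale B) U) * ψ U) := isPhys_cos_onePhase_mul _ hψ
  have hfb' : ∀ U : Cfg, |Real.cos (onePhase (onePhaseScale B) U) * ψ U| ≤ Cψ := fun U => by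
    rw [abs_mul]
    exact (mul_le_of_le_one_left (abs_nonneg _) (Real.abs_cos_le_one _)).trans (hCψ U)
  set g : Cfg → ℝ := magWeight B (fun U => Real.cos (onePhase (onePhaseScale B) U) * ψ U) with hg
  have hgm : Measurable g := measurable_magWeight B hfphys.measurable
  have hgb : ∀ U, |g U| ≤ Cψ := magWeight_bounded hBpos.le hfb'
  set G : ZM → ℝ := gFlat B ψ with hG
  have hrep : ∀ σ y, g (gnChart (bareLambda B / 2) σ y) = G y := fun σ y => magWeight_cos_gnChart hψ B σ y
  have hGm : Measurable G := measurable_gFlat B hψ.measurable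
  have hGb : ∀ y, |G y| ≤ Cψ := abs_gFlat_le hBpos.le hCψ
  have hGinv : IsGaugeInv G := isGaugeInv_gFlat B hψ
  have hGsupp : ∀ y, G y ≠ 0 → ‖y‖ ≤ 7 / Real.sqrt (bareLambda B) := fun y hy => norm_le_of_gFlat_ne_zero hBpos ht4 hy
  have hG2i : Integrable fun y => G y ^ 2 := integrable_sq_of_bounded_of_support hGm hGb hGsupp
  have hVi : Integrable fun y => luscherPotential y * G y ^ 2 := integrable_potential_mul_sq hGm hGb hGsupp
  -- orthogonality transfers
  have horthG : ∀ i, ∫ y, G y * fs i y = 0 := by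
    intro i
    obtain ⟨Mi, hMi⟩ := hfb i
    have h8 := l2_phiPullback hBpos hψ (hfc i).measurable (abs_phiFlat_le hBpos ht4 hwinφ hMi)
    have h0 := horth i
    rw [h8] at h0
    linarith
  -- the five analytic inputs
  have hM : ∫ U, g U ^ 2 ∂cfgMeasure ≤ 8 * ((bareLambda B / 2) ^ 9 * ((2 * π ^ 2)⁻¹) ^ 3) * ∫ y, G y ^ 2 :=
    integral_sq_le_of_chartRep hμ hgm ⟨Cψ, hgb⟩ hrep hG2i
  have hM0 : 0 ≤ ∫ U, g U ^ 2 ∂cfgMeasure := integral_nonneg fun U => sq_nonneg _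
  have hV := integral_action_mul_sq_ge hBpos.le hμ hgm ⟨Cψ, hgb⟩ hrep hGsupp hwin6 hVi
  have hJ := latticeJump_ge_flatJumpBall ht hgm hgb hGm hGb hrep hR6
  rw [← hBt] at hJ
  have hT := flatJump_le_flatJumpBall_add_exp ht hGm hGb hR₀ hGsupp
  have hK := hbound (bareLambda B) ht hrange G hGm ⟨Cψ, hGb⟩ hGinv hGsupp horthG
  rw [kacForm] at hK
  -- constants in the inputs
  have e8 : 8 * B * (bareLambda B / 2) ^ 4 = bareLambda B := by
    linear_combination (bareLambda B / 2) * bareLambda_cube hBpos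
  have e98 : 1 - 8 * ((bareLambda B / 2) ^ 2 * (7 / Real.sqrt (bareLambda B)) ^ 2) = 1 - 98 * bareLambda B := by
    rw [hμR₀]; ring
  have e294 : 1 - 6 * ((bareLambda B / 2) ^ 2 * (2 * (7 / Real.sqrt (bareLambda B))) ^ 2) = 1 - 294 * bareLambda B := by
    rw [h4R, hμR₀]; ring
  have e49 : (7 / Real.sqrt (bareLambda B)) ^ 2 / (4 * bareLambda B) = 49 / (4 * bareLambda B ^ 2) := by
    rw [div_pow, hsq]; field_simp; ring
  rw [e8, e98] at hV
  rw [e294] at hJ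
  rw [e49] at hT
  have hfinal := assembly_ineq ht ht600 hρ₀ hM0 hM (integral_nonneg fun y => sq_nonneg _)
    (flatJumpBall_nonneg ht _ _) (integral_nonneg fun y => mul_nonneg (luscherPotential_nonneg y) (sq_nonneg _))
    (latticeJump_nonneg hBpos.le g)
    (integral_nonneg fun U => mul_nonneg (mul_nonneg hBpos.le (wilsonAction_su2_nonneg U)) (sq_nonneg _)) hJ hV hT hK
  -- weaken the error coefficient to `(600 + 601|C'| + 2)(1+η)^(q+1)`
  have hcoef : η * bareLambda B - (600 + 601 * |C'| + 2) * (1 + η) ^ (q + 1) * bareLambda B ^ 2 ≤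
      η * bareLambda B - (600 * η + 601 * |C' * (1 + η) ^ q| + 2) * bareLambda B ^ 2 := by
    have hη1 : 0 ≤ 1 + η := by linarith
    have hpq : (1 + η) ^ q ≤ (1 + η) ^ (q + 1) := pow_le_pow_right₀ (by linarith) (Nat.le_succ q)
    have hP1 : 1 + η ≤ (1 + η) ^ (q + 1) := by
      calc 1 + η = (1 + η) ^ 1 := (pow_one _).symm
        _ ≤ (1 + η) ^ (q + 1) := pow_le_pow_right₀ (by linarith) (by omega)
    have habs : |C' * (1 + η) ^ q| = |C'| * (1 + η) ^ q := by
      rw [abs_mul, abs_of_nonneg (pow_nonneg hη1 q)]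
    rw [habs]
    have hCn : 0 ≤ |C'| := abs_nonneg C'
    have t2 : |C'| * (1 + η) ^ q ≤ |C'| * (1 + η) ^ (q + 1) := mul_le_mul_of_nonneg_left hpq hCn
    have hsum : 600 * η + 601 * (|C'| * (1 + η) ^ q) + 2 ≤ (600 + 601 * |C'| + 2) * (1 + η) ^ (q + 1) := by
      nlinarith
    have := mul_le_mul_of_nonneg_right hsum (sq_nonneg (bareLambda B))
    linarith
  exact (mul_le_mul_of_nonneg_right hcoef hM0).trans hfinal

/-! ## §4 INNERc from the flat count alone -/

/-- ★★ **INNERc from «FlatKacCount»** (layers I + II in count mode).  Feed into `OSTailCount.femtoSubspaceBound_of_innerCount` and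
`OSTailDoors.oneSiteTail_of_femtoSubspaceBound` to obtain the route item `OneSiteTail`. [cite: Luscher1983, §3] [cite: SimonB1983DiscreteSpectrum, §3] -/
theorem innerCount_of_flatKacCount
    (hF : ∃ C : ℝ, ∃ p : ℕ, ∃ C' : ℝ, ∃ q : ℕ, ∃ c₀ : ℝ, 0 < C ∧ 0 < c₀ ∧ ∀ E : ℝ, 0 ≤ E →
      ∃ n : ℕ, (n : ℝ) ≤ C * (1 + E) ^ p ∧ ∃ fs : Fin n → ZM → ℝ,
        (∀ i, Continuous (fs i)) ∧ (∀ i, ∃ M : ℝ, ∀ x, |fs i x| ≤ M) ∧ (∀ i, IsGaugeInv (fs i)) ∧ (∀ i, Integrable (fs i)) ∧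
        ∀ t : ℝ, 0 < t → (1 + E) ^ q * t ≤ c₀ → ∀ g : ZM → ℝ, Measurable g → (∃ M : ℝ, ∀ x, |g x| ≤ M) → IsGaugeInv g →
          (∀ x, g x ≠ 0 → ‖x‖ ≤ 7 / Real.sqrt t) → (∀ i, ∫ x, g x * fs i x = 0) →
          (E - C' * (1 + E) ^ q * t) * ∫ x, g x ^ 2 ≤ kacForm t g) :
    ∀ c₁ : ℝ, 0 < c₁ → ∃ C : ℝ, ∃ p : ℕ, ∃ C₁ B₁ : ℝ, 0 < C ∧ 2 ≤ B₁ ∧ ∀ B : ℝ, B₁ ≤ B → ∀ η : ℝ, 0 ≤ η → η ≤ c₁ * Real.log B →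
      ∃ n : ℕ, (n : ℝ) ≤ C * (1 + η) ^ p ∧ ∃ φs : Fin n → (GaugeConfig 3 1 SU2 → ℝ), (∀ i, IsPhys (φs i)) ∧
        ∀ ψ : GaugeConfig 3 1 SU2 → ℝ, IsPhys ψ → (∀ i, l2 ψ (φs i) = 0) →
          qform su2Rep B (fun U => Real.cos (onePhase (onePhaseScale B) U) * ψ U) (fun U => Real.cos (onePhase (onePhaseScale B) U) * ψ U)
            ≤ linkCE B * Real.exp (-(η * bareLambda B) + C₁ * bareLambda B ^ 2)
              * l2 (fun U => Real.cos (onePhase (onePhaseScale B) U) * ψ U) (fun U => Real.cos (onePhase (onePhaseScale B) U) * ψ U) :=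
  innerCount_of_jumpEnergyLowerCount (jumpEnergyLowerCount_of_flatKacCount hF)

end Summit.QuantumFields.YangMills.Theorems.FemtoTransferGap.OSTailInner

end
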